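import Mathlib
import Literature.Analysis.FluidPDE.VectorCalculus
import Summits.NavierStokesRegularity.NavierStokesRegularity.Theorems.UnthreadedDoorFluxStarvedDipoleAmplitudeIdentityAll
import Summits.NavierStokesRegularity.NavierStokesRegularity.Theorems.UnthreadedDoorFluxStarvedDipoleAncientEndgame
import HarnessLib

/-!
# Route `UnthreadedDoor`, crux `PoloidalLiouville` (stmt-NavierStokesRegularity-1222), wall W1 — crux idea
# «flux-starved-dipoles» (ns-idea-15 g12/g13, `Cruxes/PoloidalLiouville/FluxStarvedDipoleSketch.lean`):
# K1′ `DipoleNeverAncient` — NO ANCIENT TOROIDAL DIPOLE IS MAINTAINED BY ANY INCOMPRESSIBLE DRIFT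

The sketch Prop `FluxStarvedDipole.DipoleNeverAncient` VERBATIM (with `dipolePotentialT`, `dipolePotential`, `KinematicLawOn`
unfolded): slices `u(t) ∈ C¹` divergence-free (no bound on the drift), `A, R` jointly `C³` on `(−∞,0) × (0,∞)`, `‖A‖ ≤ C`, and the
time-dependent kinematic law (E1) on `(−∞,0) × {x₀}ᶜ` for the turning-axis dipole potential
`T(t,x) = ⟪A(t,‖x−x₀‖), x−x₀⟫/‖x−x₀‖ + R(t,‖x−x₀‖)` ⇒ `A ≡ 0`.

Assembly: `amplitudeIdentity_window_all` (p838751; flux starvation ⇒ `⟪A″ + (2/r)A′ − (2/r²)A − ∂ₜA, A⟫ = 0` on `{A ≠ 0}`)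
+ `eq_zero_of_amplitudeIdentity` (`…AncientEndgame`: the classical comparison endgame — `‖A‖²/r²` is a pointwise subsolution of the
radial heat operator of `ℝ⁵` wherever `A ≠ 0`, `K/(r²+2τ) + ε/r³` a strict supersolution, positive maxima of the difference sit
where `A ≠ 0`).  This closes the last piece of the card that was not in the kernel (g20 census: "K1′ parabolic endgame [XL]"); with
`dipoleNeverSteady` (p838510), `dipolarWindowIrrotational` (p839296), `dipoleStratumOfWall_smooth` (p839368) the card
«flux-starved-dipoles» is now entirely kernel-checked in its typed form.

HONEST LABEL: the dipole (`l = 1`) stratum of the LINEAR kinematic shadow of W1 (critic V28: information-grade, W1 movement 0 — it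
says where a counterexample to W1 cannot live); `PoloidalLiouville` (1222), its wall `stub_scalarLiouville` and the summit stay OPEN;
NO Navier–Stokes regularity statement is proved.  `--supports stmt-NavierStokesRegularity-1222` (helper).  [folklore]
-/

noncomputable section

-- the summit and its single sub-problem share the name (CONVENTIONS §1)
set_option linter.dupNamespace false

open Set Filter Topology InnerProductSpace
open scoped RealInnerProductSpace Laplacian
open Literature.Analysis.FluidPDE
open Summit.NavierStokesRegularity.NavierStokesRegularity.Theorems.PoloidalLiouville.HorizonTower (E3)

namespace Summit.NavierStokesRegularity.NavierStokesRegularity.Theorems.PoloidalLiouville.FluxStarvedDipole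

/-- **K1′ — NO ANCIENT DIPOLE** (the sketch Prop `FluxStarvedDipole.DipoleNeverAncient`, VERBATIM-unfolded): slices
`u(t) ∈ C¹` divergence-free, `A, R` jointly `C³` on `(−∞,0) × (0,∞)`, `‖A‖ ≤ C`, the time-dependent law (E1) on
`(−∞,0) × {x₀}ᶜ` for the turning-axis dipole potential ⇒ `A(t,r) = 0` for all `t < 0`, `r > 0`.  No bound on the drift, no
coupling `curl u = ∇T × (x−x₀)`, no smoothness at the centre, no axisymmetry. [folklore] -/
theorem dipoleNeverAncient :
    ∀ (u : ℝ → E3 → E3) (x₀ : E3) (A : ℝ → ℝ → E3) (R : ℝ → ℝ → ℝ) (C : ℝ),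
      (∀ t < 0, ContDiff ℝ 1 (u t)) → (∀ t < 0, Literature.Analysis.FluidPDE.VectorCalculus.IsDivFree (u t)) →
      ContDiffOn ℝ 3 (Function.uncurry A) (Set.Iio 0 ×ˢ Set.Ioi 0) →
      ContDiffOn ℝ 3 (Function.uncurry R) (Set.Iio 0 ×ˢ Set.Ioi 0) →
      (∀ t < 0, ∀ r > 0, ‖A t r‖ ≤ C) →
      (∀ t ∈ Set.Iio (0 : ℝ), ∀ x, x ≠ x₀ →
        cross (gradient (fun z => deriv (fun s => ⟪A s ‖z - x₀‖, z - x₀⟫ / ‖z - x₀‖ + R s ‖z - x₀‖) t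
            + ⟪u t z, gradient (fun x => ⟪A t ‖x - x₀‖, x - x₀⟫ / ‖x - x₀‖ + R t ‖x - x₀‖) z⟫
            - Δ (fun x => ⟪A t ‖x - x₀‖, x - x₀⟫ / ‖x - x₀‖ + R t ‖x - x₀‖) z) x) (x - x₀)
          = cross (gradient (fun z => ⟪u t z, z - x₀⟫) x)
              (gradient (fun x => ⟪A t ‖x - x₀‖, x - x₀⟫ / ‖x - x₀‖ + R t ‖x - x₀‖) x)) →
      ∀ t < 0, ∀ r > 0, A t r = 0 := by
  intro u x₀ A R C hu hdiv hA hR hb hlaw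
  have hid := amplitudeIdentity_window_all (Set.Iio 0) u x₀ A R isOpen_Iio (fun t ht => hu t ht)
    (fun t ht => hdiv t ht) hA hR hlaw
  exact eq_zero_of_amplitudeIdentity A (hA.of_le (by norm_num)) hb (fun t ht r hr h0 => hid t ht r hr h0)

end Summit.NavierStokesRegularity.NavierStokesRegularity.Theorems.PoloidalLiouville.FluxStarvedDipole

end
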